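import Summits.BirchSwinnertonDyer.BirchSwinnertonDyer.Theses.AdditiveKolyvaginRoad
import HarnessLib

/-!
# AdditiveKolyvaginRoad — the type-split glue of crux `KolyvaginPrimitiveAdditive` (item 20420), PROVED

Route `route-BirchSwinnertonDyer-AdditiveKolyvaginRoad`, rev 6 (commit bacb271f4921): the deciding crux
`KolyvaginPrimitiveAdditive` (stmt-BirchSwinnertonDyer-20132) was split by LOCAL TYPE at `p` into
`KolyvaginPrimitiveAdditiveAbelianType` (stmt-…-20418: `SubM W p ∨ SubGord W p`, potentially multiplicative or
potentially good of abelian tame type) and `KolyvaginPrimitiveAdditiveNonAbelianType` (stmt-…-20419: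
`SubTprime W p ∨ SubW W p`), with glue item `KolyvaginPrimitiveAdditiveGlue` (stmt-…-20420) =
`AbelianType → NonAbelianType → KolyvaginPrimitiveAdditive`. This file proves the glue from the tree theorem
`Summit.BirchSwinnertonDyer.Rank1Residual.Additive.sub_exhaustive` (`SubM ∨ SubGord ∨ SubTprime ∨ SubW` for every
`W`, `p`), and the parent from the two children (`kolyvaginPrimitiveAdditive_of_types`). No `sorry`, standard axioms.
Author of the split and of the proof text: planner bsd-wall-add g3 (tenure, HOME/bsd-wall-add/g3/GlueProof.lean); landed by the lead
prover bsd-wall-akr-p1 g2 (`--workitem stmt-BirchSwinnertonDyer-20420`). [cite: WZhang2014, Thm. 1.1 (the crux being split)]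
-/

-- single-conjunct summit: `Summit.BirchSwinnertonDyer.BirchSwinnertonDyer.…` repeats the name by design
set_option linter.dupNamespace false

namespace Summit.BirchSwinnertonDyer.BirchSwinnertonDyer.Theorems.AdditiveKoly

open Summit.BirchSwinnertonDyer.BirchSwinnertonDyer.Theses.AdditiveKolyvaginRoad

/-- The glue item of the type split, by name. -/
theorem kolyvaginPrimitiveAdditiveGlue : KolyvaginPrimitiveAdditiveGlue := by
  intro hA hB W _ _ _ p _ K _ _ Dt β ι h5 hadd
  rcases Summit.BirchSwinnertonDyer.Rank1Residual.Additive.sub_exhaustive W p with hM | hG | hT | hW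
  · exact hA W p K Dt β ι h5 hadd (Or.inl hM)
  · exact hA W p K Dt β ι h5 hadd (Or.inr hG)
  · exact hB W p K Dt β ι h5 hadd (Or.inl hT)
  · exact hB W p K Dt β ι h5 hadd (Or.inr hW)

/-- The parent crux from the two children (the glue applied). -/
theorem kolyvaginPrimitiveAdditive_of_types
    (hA : KolyvaginPrimitiveAdditiveAbelianType) (hB : KolyvaginPrimitiveAdditiveNonAbelianType) :
    KolyvaginPrimitiveAdditive :=
  kolyvaginPrimitiveAdditiveGlue hA hB

end Summit.BirchSwinnertonDyer.BirchSwinnertonDyer.Theorems.AdditiveKoly
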